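import Summits.HodgeConjecture.HodgeConjecture.Theorems.F0P6aTwistData                  -- ★ p849712 (LA7-p02 (g3)): (S6) rows (a)(b)(c), level-adapted correspondents, heads
import Literature.NumberTheory.LFunctions.RayClassSplitPrimeIdeleRepresentative        -- (S6+) FILE 3: totally split degree-one prime representatives (Landau)
import HarnessLib

/-!
# Crux `HLiu418` — P6 sub-line **F0-P6a**, organ (S6+) «TWIST DATA, row (d): COPRIME TO ITS CONJUGATE» for the sheet line `stub_ESHEET`

Cell `hodgecm-mathlib` (D-0151), crux `stmt-HodgeConjecture-24832` (hLiu418), `--supports … --as helper` (count-neutral).  LA5-plan (g3) DEAL L5-#4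
(S6) → LA7-p02 (g3), FOLLOW-UP to ★ `Theorems/F0P6aTwistData.lean`: LA5-p02 (g3) (Q3, 2026-09-02T06:03Z) — the (S1a) Serre-cover head ★ p849706
`AbelianSchemeOver.exists_serreTwist_cover_rows` (LA7-p01 (g3)) reads its pair `(a, b)` («`1 − a ∈ 𝔞`, `b ∈ 𝔞`», Rosati) only when the twist ideal is
COPRIME TO ITS CONJUGATE, `𝔞_γ + c•𝔞_γ = (1)` — row (d), not in the letter `RecordESheetReading` but a real obligation on the datum the closer feeds to
(S1)∕(S4).  THEOREMS ONLY (no definition, no instance, no notation, no named fact, no `sorry`); no `Cruxes/…/Lines` import.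

THE MATHEMATICS.  The generic representative of ★ `F0P6aTwistData` §1–§2 is the type product `∏_{g∈Φ} g•𝔟` of an integral `𝔟` prime to `N` in the
right narrow ray class; row (d) FAILS for a general `𝔟` (a prime `𝔮 ∣ 𝔟` with `c ∈ Φ·D_𝔮·Φ⁻¹` is shared by the two products).  Choose instead
`𝔟 := 𝔮` A TOTALLY SPLIT DEGREE-ONE PRIME in the class (Landau 1918: every narrow ray class mod `𝔪` contains infinitely many degree-one primes,
★ `PrimesInRayClasses`; discard the finitely many ramified ones, ★ `RayClassSplitPrimeIdeleRepresentative` §1–§2): then `g ↦ g•𝔮` is INJECTIVE on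
`Gal(F∕ℚ)`, the `Φ`-orbit and the `Φᶜ = c̄Φ`-orbit of `𝔮` are disjoint sets of distinct maximal ideals, and `𝔞 := ∏_{g∈Φ} g•𝔮` satisfies (a)
`(q) = 𝔞·c•𝔞` (`q = N𝔮` prime), (b), (c) AND (d) `𝔞 + c•𝔞 = (1)` (§1).  §2: every `σ ∈ Aut(ℂ∕τF)` has an Artin correspondent `s ≡ 1 mod 𝔪` whose ideal
`(s) = 𝔮` IS such a prime, outside any finite set (★ FILE 3 `exists_mul_unitEmbedding_prime_congr` moved inside the class by ★
`IsArtinCorrespondent.mul_unitEmbedding_inv`).  §3: row (d) rides INSIDE the abstract admissibility of the ★ heads — `Adm′ γ 𝔞 n := Adm γ 𝔞 n ∧ 𝔞 + c•𝔞 = (1)`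
— so ★ `exists_twistData` ∕ ★ `exists_twistData_letterRows` need no new edition: `exists_twistData_coprime` records the four-row abstract head (the
Frobenius datum `𝔞₀ = 𝔞_can` is coprime to its conjugate under the letter՚s `UnmixedAt` guard — input `h₀d`, organ-#4∕(S7) side).

HONEST LABEL.  HC_CM is proved only modulo the 7 printed citations (2 remaining named inputs: hLiu418 = stmt-HodgeConjecture-24832, h413 =
stmt-HodgeConjecture-24833) until rung 0 closes; nothing here changes a count.
[cite: Shimura1998, §8.3 Prop. 29 p. 63; §13.1 Thm. 1 pp. 97–99] [cite: Landau1918Idealklassen, §1 Satz] [cite: NeukirchANT1999, Ch. I §9; Ch. VI §1 Prop. (1.9) pp. 364–365]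
[cite: Milne2005ShimuraVarieties, (59) p. 107]
-/

set_option autoImplicit false
set_option linter.dupNamespace false  -- `Summit.HodgeConjecture.HodgeConjecture.…` BY DESIGN (D-0017)

noncomputable section

open NumberField IsDedekindDomain
open scoped Pointwise nonZeroDivisors
open Literature.NumberTheory.GaloisRepresentations (modulusExp)
open Literature.AlgebraicGeometry.ShimuraVarieties (UnitaryCanonicalModel.IsArtinCorrespondent)
open Summit.HodgeConjecture.HodgeConjecture.Theorems.F0P6aTwistData

namespace Summit.HodgeConjecture.HodgeConjecture.Theorems.F0P6aTwistDataCoprime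

variable {F : Type} [Field F] [NumberField F] [IsCMField F]

/-! ### §1 Rows (a)(b)(c)(d) for the CM-type product of a TOTALLY SPLIT prime -/

/-- **Row (d) for a totally split prime**: if `g ↦ g•𝔮` is injective on `Gal(F∕ℚ)` and `Φ ⊆ Gal(F∕ℚ)` is a CM type (`g ∈ Φ ↔ c̄g ∉ Φ`), then
`∏_{g∈Φ} g•𝔮 + c•∏_{g∈Φ} g•𝔮 = (1)` (the `Φ`- and `c̄Φ = Φᶜ`-orbits of `𝔮` are disjoint families of DISTINCT maximal ideals, pairwise comaximal).
[cite: NeukirchANT1999, Ch. I §9] [cite: Shimura1998, §13.1 Thm. 1 pp. 97–99] -/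
theorem typeProd_sup_complexConj_smul_typeProd_eq_top (Φ : Finset (F ≃ₐ[ℚ] F))
    (hΦ : ∀ g : F ≃ₐ[ℚ] F, g ∈ Φ ↔ ((IsCMField.complexConj F).restrictScalars ℚ) * g ∉ Φ) {v : HeightOneSpectrum (𝓞 F)}
    (hinj : Function.Injective fun g : F ≃ₐ[ℚ] F => g • v) :
    (∏ g ∈ Φ, g • v.asIdeal) ⊔ (IsCMField.complexConj F) • (∏ g ∈ Φ, g • v.asIdeal) = ⊤ := by
  classical
  set c : F ≃ₐ[ℚ] F := (IsCMField.complexConj F).restrictScalars ℚ with hc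
  rw [← restrictScalars_complexConj_smul_ideal, ← hc, Finset.smul_prod']
  simp_rw [smul_smul]
  rw [← Ideal.isCoprime_iff_sup_eq]
  refine IsCoprime.prod_left fun g hg => IsCoprime.prod_right fun h hh => ?_
  rw [Ideal.isCoprime_iff_sup_eq, ← Literature.NumberTheory.Automorphic.HeightOneSpectrum.smul_asIdeal,
    ← Literature.NumberTheory.Automorphic.HeightOneSpectrum.smul_asIdeal]
  refine Ideal.IsMaximal.coprime_of_ne (g • v).isMaximal ((c * h) • v).isMaximal fun e => ?_
  have hgh : g = c * h := hinj (HeightOneSpectrum.ext e)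
  exact (hΦ h).mp hh (hgh ▸ hg)

omit [IsCMField F] in
/-- **Row (b) input for a prime away from `N`**: `𝔭_v + (N) = (1)` when `(N) ⊄ 𝔭_v`. [folklore] -/
theorem asIdeal_sup_span_natCast_eq_top {v : HeightOneSpectrum (𝓞 F)} {N : ℕ} (hvN : ¬ Ideal.span {((N : ℕ) : 𝓞 F)} ≤ v.asIdeal) :
    v.asIdeal ⊔ Ideal.span {((N : ℕ) : 𝓞 F)} = ⊤ :=
  v.isMaximal.out.2 _ (lt_of_le_of_ne le_sup_left fun e => hvN (e ▸ le_sup_right))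

/-- **THE SPLIT-PRIME TWIST DATUM — rows (a)(b)(c)(d)**: for `F ∕ ℚ` Galois CM, a CM type `Φ ⊆ Gal(F∕ℚ)` and a prime `𝔮` with `N𝔮 = q`, `(N) ⊄ 𝔮` and
injective orbit map `g ↦ g•𝔮` (totally split), the datum `𝔞 := ∏_{g∈Φ} g•𝔮`, `n := q` has (a) `(q) = 𝔞·c•𝔞`, (b) `𝔞 + (N) = (1)`, (c) `𝔞 ≠ 0`, (d) `𝔞 + c•𝔞 = (1)`.
[cite: Shimura1998, §8.3 Prop. 29 p. 63; §13.1 Thm. 1 pp. 97–99] [cite: NeukirchANT1999, Ch. I §9] -/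
theorem splitPrime_typeProd_twistRows [IsGalois ℚ F] (Φ : Finset (F ≃ₐ[ℚ] F))
    (hΦ : ∀ g : F ≃ₐ[ℚ] F, g ∈ Φ ↔ ((IsCMField.complexConj F).restrictScalars ℚ) * g ∉ Φ) {v : HeightOneSpectrum (𝓞 F)} {N : ℕ}
    (hvN : ¬ Ideal.span {((N : ℕ) : 𝓞 F)} ≤ v.asIdeal) (hinj : Function.Injective fun g : F ≃ₐ[ℚ] F => g • v) :
    Ideal.span {((Ideal.absNorm v.asIdeal : ℕ) : 𝓞 F)} =
        (∏ g ∈ Φ, g • v.asIdeal) * (IsCMField.complexConj F) • (∏ g ∈ Φ, g • v.asIdeal) ∧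
      (∏ g ∈ Φ, g • v.asIdeal) ⊔ Ideal.span {((N : ℕ) : 𝓞 F)} = ⊤ ∧ (∏ g ∈ Φ, g • v.asIdeal) ≠ ⊥ ∧
      (∏ g ∈ Φ, g • v.asIdeal) ⊔ (IsCMField.complexConj F) • (∏ g ∈ Φ, g • v.asIdeal) = ⊤ :=
  let h := typeProd_twistRows Φ hΦ v.ne_bot (asIdeal_sup_span_natCast_eq_top hvN)
  ⟨h.1, h.2.1, h.2.2, typeProd_sup_complexConj_smul_typeProd_eq_top Φ hΦ hinj⟩

/-! ### §2 Artin correspondents whose ideal is a totally split degree-one prime -/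

/-- **Every `σ ∈ Aut(ℂ∕τF)` has an Artin correspondent `s ≡ 1 mod 𝔪` WHOSE IDEAL IS A TOTALLY SPLIT DEGREE-ONE PRIME outside any finite set `S`**
(`F ∕ ℚ` Galois): `(s) = 𝔮`, `𝔮 ∉ S`, `𝔮 ∤ 𝔪`, `N𝔮 = q` prime, `g•𝔮 = h•𝔮 ⇒ g = h`, `|s_v|_v = 1 ∧ |s_v − 1|_v ≤ q_v^{-n_v}` at `v ∣ 𝔪` — ★
`exists_finiteIdele_isArtinCorrespondent` + ★ FILE 3 `exists_mul_unitEmbedding_prime_congr` + ★ `IsArtinCorrespondent.mul_unitEmbedding_inv`.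
[cite: Milne2005ShimuraVarieties, (59) p. 107] [cite: Landau1918Idealklassen, §1 Satz] [cite: NeukirchANT1999, Ch. VI §1 Prop. (1.9) pp. 364–365] -/
theorem exists_isArtinCorrespondent_splitPrime_congr [IsGalois ℚ F] (τ : F →+* ℂ) (σ : ℂ ≃+* ℂ) (hσ : ∀ x : F, σ (τ x) = τ x)
    {𝔪 : Ideal (𝓞 F)} (h𝔪 : 𝔪 ≠ ⊥) (S : Set (HeightOneSpectrum (𝓞 F))) (hS : S.Finite) :
    ∃ (s : (FiniteAdeleRing (𝓞 F) F)ˣ) (v : HeightOneSpectrum (𝓞 F)),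
      UnitaryCanonicalModel.IsArtinCorrespondent F τ s σ ∧ v ∉ S ∧ ¬ 𝔪 ≤ v.asIdeal ∧ (Ideal.absNorm v.asIdeal).Prime ∧
      (Function.Injective fun g : F ≃ₐ[ℚ] F => g • v) ∧
      Literature.NumberTheory.Automorphic.FiniteAdeleRing.toFractionalIdeal (𝓞 F) F s = (v.asIdeal : FractionalIdeal (𝓞 F)⁰ F) ∧
      ∀ v' : HeightOneSpectrum (𝓞 F), 𝔪 ≤ v'.asIdeal →
        Valued.v ((s : FiniteAdeleRing (𝓞 F) F) v') = 1 ∧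
        Valued.v ((s : FiniteAdeleRing (𝓞 F) F) v' - 1) ≤ WithZero.exp (-(modulusExp 𝔪 v' : ℤ)) := by
  obtain ⟨s₀, hs₀⟩ :=
    Literature.AlgebraicGeometry.ShimuraVarieties.UnitaryCanonicalModel.exists_finiteIdele_isArtinCorrespondent F τ σ hσ
  obtain ⟨a, v, hvS, hv𝔪, hq, h2, hid, hv⟩ :=
    Literature.NumberTheory.LFunctions.exists_mul_unitEmbedding_prime_congr h𝔪 s₀ S hS
  refine ⟨s₀ * FiniteAdeleRing.unitEmbedding (𝓞 F) F a, v, ?_, hvS, hv𝔪, hq,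
    Literature.NumberTheory.LFunctions.smul_injective_of_not_sq_dvd_span_absNorm h2, hid, hv⟩
  have h := hs₀.mul_unitEmbedding_inv F τ a⁻¹
  rwa [map_inv, inv_inv] at h

/-- **Re-adapting a GIVEN correspondent to a split-prime representative**: if `s ↔ σ` then `s·a ↔ σ` with `(s·a) = 𝔮` a totally split degree-one
prime `∉ S`, `𝔮 ∤ 𝔪`, `s·a ≡ 1 mod 𝔪`. [cite: Milne2005ShimuraVarieties, (59) p. 107] [cite: Landau1918Idealklassen, §1 Satz] -/
theorem exists_mul_unitEmbedding_isArtinCorrespondent_splitPrime_congr [IsGalois ℚ F] {τ : F →+* ℂ} {σ : ℂ ≃+* ℂ}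
    {s : (FiniteAdeleRing (𝓞 F) F)ˣ} (hs : UnitaryCanonicalModel.IsArtinCorrespondent F τ s σ) {𝔪 : Ideal (𝓞 F)} (h𝔪 : 𝔪 ≠ ⊥)
    (S : Set (HeightOneSpectrum (𝓞 F))) (hS : S.Finite) :
    ∃ (a : Fˣ) (v : HeightOneSpectrum (𝓞 F)),
      UnitaryCanonicalModel.IsArtinCorrespondent F τ (s * FiniteAdeleRing.unitEmbedding (𝓞 F) F a) σ ∧ v ∉ S ∧ ¬ 𝔪 ≤ v.asIdeal ∧
      (Ideal.absNorm v.asIdeal).Prime ∧ (Function.Injective fun g : F ≃ₐ[ℚ] F => g • v) ∧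
      Literature.NumberTheory.Automorphic.FiniteAdeleRing.toFractionalIdeal (𝓞 F) F (s * FiniteAdeleRing.unitEmbedding (𝓞 F) F a) =
        (v.asIdeal : FractionalIdeal (𝓞 F)⁰ F) ∧
      ∀ v' : HeightOneSpectrum (𝓞 F), 𝔪 ≤ v'.asIdeal →
        Valued.v (((s * FiniteAdeleRing.unitEmbedding (𝓞 F) F a : (FiniteAdeleRing (𝓞 F) F)ˣ) : FiniteAdeleRing (𝓞 F) F) v') = 1 ∧
        Valued.v (((s * FiniteAdeleRing.unitEmbedding (𝓞 F) F a : (FiniteAdeleRing (𝓞 F) F)ˣ) : FiniteAdeleRing (𝓞 F) F) v' - 1) ≤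
          WithZero.exp (-(modulusExp 𝔪 v' : ℤ)) := by
  obtain ⟨a, v, hvS, hv𝔪, hq, h2, hid, hv⟩ :=
    Literature.NumberTheory.LFunctions.exists_mul_unitEmbedding_prime_congr h𝔪 s S hS
  refine ⟨a, v, ?_, hvS, hv𝔪, hq, Literature.NumberTheory.LFunctions.smul_injective_of_not_sq_dvd_span_absNorm h2, hid, hv⟩
  have h := hs.mul_unitEmbedding_inv F τ a⁻¹
  rwa [map_inv, inv_inv] at h

/-! ### §3 HEAD with row (d): admissibility carries the coprimality -/

/-- **HEAD (S6+) «TWIST DATA WITH ROW (d)», abstract form**: as ★ `exists_twistData`, with the extra row (d) `𝔞 + c•𝔞 = (1)` demanded of the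
distinguished datum (`h₀d`) and of the generic data (`hgen`), and delivered for every `γ` — by ★ `exists_twistData` applied to the admissibility
`Adm′ γ 𝔞 n := Adm γ 𝔞 n ∧ 𝔞 + c•𝔞 = (1)` (so the letter-shaped ★ `exists_twistData_letterRows` serves row (d) the same way, with no new edition).
[cite: Shimura1998, §13.1 Thm. 1 pp. 97–99; §18.6 Thm. 18.6 pp. 124–125] -/
theorem exists_twistData_coprime {Γ : Type*} (Frob : Γ → Prop) (Adm : Γ → Ideal (𝓞 F) → ℕ → Prop) (N : ℕ) (𝔞₀ : Ideal (𝓞 F)) (n₀ : ℕ)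
    (h₀a : Ideal.span {((n₀ : ℕ) : 𝓞 F)} = 𝔞₀ * (IsCMField.complexConj F) • 𝔞₀)
    (h₀b : 𝔞₀ ⊔ Ideal.span {((N : ℕ) : 𝓞 F)} = ⊤) (h₀c : 𝔞₀ ≠ ⊥) (h₀d : 𝔞₀ ⊔ (IsCMField.complexConj F) • 𝔞₀ = ⊤)
    (h₀adm : ∀ γ, Frob γ → Adm γ 𝔞₀ n₀)
    (hgen : ∀ γ, ∃ (𝔞 : Ideal (𝓞 F)) (n : ℕ), Adm γ 𝔞 n ∧
      Ideal.span {((n : ℕ) : 𝓞 F)} = 𝔞 * (IsCMField.complexConj F) • 𝔞 ∧ 𝔞 ⊔ Ideal.span {((N : ℕ) : 𝓞 F)} = ⊤ ∧ 𝔞 ≠ ⊥ ∧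
      𝔞 ⊔ (IsCMField.complexConj F) • 𝔞 = ⊤) :
    ∃ (twistIdeal : Γ → Ideal (𝓞 F)) (twistNorm : Γ → ℕ),
      (∀ γ, Ideal.span {((twistNorm γ : ℕ) : 𝓞 F)} = twistIdeal γ * (IsCMField.complexConj F) • twistIdeal γ) ∧
      (∀ γ, twistIdeal γ ⊔ Ideal.span {((N : ℕ) : 𝓞 F)} = ⊤) ∧
      (∀ γ, twistIdeal γ ≠ ⊥) ∧
      (∀ γ, twistIdeal γ ⊔ (IsCMField.complexConj F) • twistIdeal γ = ⊤) ∧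
      (∀ γ, Frob γ → twistIdeal γ = 𝔞₀ ∧ twistNorm γ = n₀) ∧
      (∀ γ, Adm γ (twistIdeal γ) (twistNorm γ)) := by
  obtain ⟨tI, tN, ha, hb, hc, hfrob, hadm⟩ := exists_twistData Frob
    (fun γ 𝔞 n => Adm γ 𝔞 n ∧ 𝔞 ⊔ (IsCMField.complexConj F) • 𝔞 = ⊤) N 𝔞₀ n₀ h₀a h₀b h₀c
    (fun γ h => ⟨h₀adm γ h, h₀d⟩)
    (fun γ => by
      obtain ⟨𝔞, n, hA, hA1, hA2, hA3, hA4⟩ := hgen γ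
      exact ⟨𝔞, n, ⟨hA, hA4⟩, hA1, hA2, hA3⟩)
  exact ⟨tI, tN, ha, hb, hc, fun γ => (hadm γ).2, hfrob, fun γ => (hadm γ).1⟩

/-! ### §4 (ED. 2) Row (e): the twist norm is prime to a given `D` (the polarisation type `∏ δᵢ` of the `HasType` engine) -/

omit [IsCMField F] in
/-- **Row (e) for a degree-one prime away from `D`**: `N𝔮 = q` prime and `(D) ⊄ 𝔮` give `q` coprime to `D` (`q ∣ D ⇒ D ∈ (q) ⊆ 𝔮`, as
`N𝔮 ∈ 𝔮`).  LA4-p05 (g3) 2026-09-02T06:17Z: the ★ `Polarization.hasType_serreTwist_of_count` engine needs `Nat.Coprime n_γ (∏ δᵢ)`; for the split-prime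
datum `n_γ = N𝔮`, so the closer puts the finitely many primes containing `D` (★ `AbelianSchemes.finite_setOf_natCast_mem_asIdeal`) into the avoided set
`S` of ★ `exists_isArtinCorrespondent_splitPrime_congr`. [folklore] -/
theorem natCoprime_absNorm_of_not_span_natCast_le {v : HeightOneSpectrum (𝓞 F)} (hq : (Ideal.absNorm v.asIdeal).Prime) {D : ℕ}
    (hvD : ¬ Ideal.span {((D : ℕ) : 𝓞 F)} ≤ v.asIdeal) : Nat.Coprime (Ideal.absNorm v.asIdeal) D := by
  refine (Nat.Prime.coprime_iff_not_dvd hq).mpr fun hdvd => hvD ?_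
  rw [Ideal.span_singleton_le_iff_mem]
  obtain ⟨k, hk⟩ := hdvd
  rw [hk, Nat.cast_mul]
  exact v.asIdeal.mul_mem_right _ (Ideal.absNorm_mem v.asIdeal)

omit [NumberField F] [IsCMField F] in
/-- `(D) ⊄ 𝔮` when `𝔮` lies outside the set of primes containing `D` (the form in which the avoided set is fed). [folklore] -/
theorem not_span_natCast_le_of_not_mem {v : HeightOneSpectrum (𝓞 F)} {D : ℕ}
    (hv : v ∉ {w : HeightOneSpectrum (𝓞 F) | ((D : ℕ) : 𝓞 F) ∈ w.asIdeal}) : ¬ Ideal.span {((D : ℕ) : 𝓞 F)} ≤ v.asIdeal := by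
  rwa [Ideal.span_singleton_le_iff_mem]

/-- **THE SPLIT-PRIME TWIST DATUM — rows (a)(b)(c)(d)(e)**: as `splitPrime_typeProd_twistRows`, plus (e) `Nat.Coprime (N𝔮) D` for a prime `𝔮` with
`(D) ⊄ 𝔮` — the datum `(∏_{g∈Φ} g•𝔮, N𝔮)` meets every arithmetic demand made so far on the generic twist ((a)(b)(c) letter, (d) Serre-cover pair, (e)
`HasType` engine). [cite: Shimura1998, §8.3 Prop. 29 p. 63; §13.1 Thm. 1 pp. 97–99] [cite: NeukirchANT1999, Ch. I §9] -/
theorem splitPrime_typeProd_twistRows₅ [IsGalois ℚ F] (Φ : Finset (F ≃ₐ[ℚ] F))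
    (hΦ : ∀ g : F ≃ₐ[ℚ] F, g ∈ Φ ↔ ((IsCMField.complexConj F).restrictScalars ℚ) * g ∉ Φ) {v : HeightOneSpectrum (𝓞 F)} {N D : ℕ}
    (hq : (Ideal.absNorm v.asIdeal).Prime) (hvN : ¬ Ideal.span {((N : ℕ) : 𝓞 F)} ≤ v.asIdeal) (hvD : ¬ Ideal.span {((D : ℕ) : 𝓞 F)} ≤ v.asIdeal)
    (hinj : Function.Injective fun g : F ≃ₐ[ℚ] F => g • v) :
    Ideal.span {((Ideal.absNorm v.asIdeal : ℕ) : 𝓞 F)} =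
        (∏ g ∈ Φ, g • v.asIdeal) * (IsCMField.complexConj F) • (∏ g ∈ Φ, g • v.asIdeal) ∧
      (∏ g ∈ Φ, g • v.asIdeal) ⊔ Ideal.span {((N : ℕ) : 𝓞 F)} = ⊤ ∧ (∏ g ∈ Φ, g • v.asIdeal) ≠ ⊥ ∧
      (∏ g ∈ Φ, g • v.asIdeal) ⊔ (IsCMField.complexConj F) • (∏ g ∈ Φ, g • v.asIdeal) = ⊤ ∧
      Nat.Coprime (Ideal.absNorm v.asIdeal) D :=
  let h := splitPrime_typeProd_twistRows Φ hΦ hvN hinj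
  ⟨h.1, h.2.1, h.2.2.1, h.2.2.2, natCoprime_absNorm_of_not_span_natCast_le hq hvD⟩

end Summit.HodgeConjecture.HodgeConjecture.Theorems.F0P6aTwistDataCoprime

end
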